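import Literature.NumberTheory.LFunctions.WeilTwoPrimeDeflL2Def
import HarnessLib

/-!
# Deflated two-prime certificate L2: the value of `κ`, `β₂₃ ≤ κ`, `κ − β₂₃ = κ'`, and the scalar side conditions

`weilCertDeflL2.kappaQ` evaluated by the kernel, the level identities, and `checkScalars` with `κ` rewritten to its value first. Pure proof file.
-/

noncomputable section

namespace Literature.NumberTheory.LFunctions

set_option maxHeartbeats 0 in
/-- **The value of `κ`** of certificate L2. [folklore] -/
theorem kappaQ_weilCertDeflL2 : weilCertDeflL2.kappaQ = weilCertDeflL2KappaLit := by
  have h : decide (weilCertDeflL2.kappaQ = weilCertDeflL2KappaLit) = true := by decide +kernel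
  exact of_decide_eq_true h

/-- `β₂₃ ≤ κ` for certificate L2. [folklore] -/
theorem beta_le_kappaQ_weilCertDeflL2 : weilCertDeflL2Beta ≤ weilCertDeflL2.kappaQ := by
  rw [kappaQ_weilCertDeflL2]; unfold weilCertDeflL2Beta weilCertDeflL2KappaLit; norm_num

/-- `κ − β₂₃ = κ'` for certificate L2. [folklore] -/
theorem kappaQ_sub_beta_weilCertDeflL2 : weilCertDeflL2.kappaQ - weilCertDeflL2Beta = weilCertDeflL2Kappa' := by
  rw [kappaQ_weilCertDeflL2]; unfold weilCertDeflL2Beta weilCertDeflL2KappaLit weilCertDeflL2Kappa'; norm_num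

set_option maxHeartbeats 0 in
/-- **Kernel check of the scalar side conditions** of certificate L2. [folklore] -/
theorem checkScalars_weilCertDeflL2 : weilCertDeflL2.checkScalars = true := by
  have h : weilCertDeflL2.checkScalars = (decide (1 ≤ weilCertDeflL2.j) && decide (0 < weilCertDeflL2.b) && decide (weilCertDeflL2.b ≤ weilCertDeflL2.base.a0) &&
      decide (weilCertDeflL2.base.a0 ≤ 1) && decide (0 < weilCertDeflL2.base.T) && decide (2 * weilCertDeflL2.base.a0 * weilCertDeflL2.base.T ≤ (weilCertDeflL2.base.N : ℚ) + 2) &&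
      decide (2 * (weilCertDeflL2.base.a0 * weilCertDeflL2.base.T) ^ (weilCertDeflL2.base.N + 1) / (weilCertDeflL2.base.N + 1).factorial ≤ 1) &&
      decide (weilCertDeflL2.base.N + 1 = 2 * weilCertDeflL2.base.nb) && decide (0 ≤ weilCertDeflL2.kappaQ)) := rfl
  rw [h, kappaQ_weilCertDeflL2]
  decide +kernel

end Literature.NumberTheory.LFunctions
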